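import Summits.NavierStokesRegularity.NavierStokesRegularity.Theses.PumpContinuation
import Summits.NavierStokesRegularity.NavierStokesRegularity.Theorems.PumpContinuationEulerProximatePumpScalingTools
import Summits.NavierStokesRegularity.NavierStokesRegularity.Theorems.PerpetualPumpThesisBilinearOperatorForm
import Literature.Analysis.FluidPDE.TaoAveragedComplexAverageReal

/-!
# Route PumpContinuation · crux `EulerProximatePump` — stub `stub_accumulatingOfDoor` (line `SketchIdeator2`)

Amplitude normalisation of the Door, direction "segment form ⇒ `B + η B̃_𝒜` form".

The Door (`Theses.PumpContinuation.EulerProximatePump`) provides a symmetric cancelling averaging datum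
`𝒜`, a ceiling `M` and, for every `δ > 0`, a parameter `θ ∈ (1-δ, 1)` at which the segment form
`T_θ = (1-θ) B̃_𝒜 + θ B` — typed over Tao's mild formulation (2016, (1.15)) — admits a Schwartz-data
`H¹⁰_df`-mild Type-I blow-up at ceiling `M` with no mild extension.  The scaling `u ↦ θ u` of Tao's mild
formulation (landed Tools stub, `typeIBlowup_smul`) carries a `T_θ`-mild solution to a mild solution of
the amplitude-normalised form `B + η B̃_𝒜` with `η = (1-θ)/θ`, because both forms are homogeneous of
degree two in `(u, u)`: `θ² B + η θ² B̃_𝒜 = θ · T_θ` (`normalisedForm_smul`).  The blow-up time and the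
non-extension clause are unchanged, the Type-I ceiling becomes `θ M ≤ |M|`, and `η → 0⁺` as `θ → 1⁻`
(for `η₀ > 0` take `δ = η₀/(1+η₀)`, so that `θ > 1/(1+η₀)` is exactly `η < η₀`).  Hence the Door implies:
`B + η B̃_𝒜` has a Schwartz-data mild Type-I blow-up at the FIXED ceiling `|M|` with no mild extension for
arbitrarily small `η > 0` (`stub_accumulatingOfDoor`, the registered stub, last theorem of the file).

## References

* T. Tao, *Finite time blowup for an averaged three-dimensional Navier–Stokes equation*, J. Amer. Math.
  Soc. 29 (2016), 601–674, arXiv:1402.0290v3, §1.1 (1.15). [Tao2016AveragedNS]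
-/

noncomputable section

-- the nested summit namespace `…NavierStokesRegularity.NavierStokesRegularity…` is the tree's layout (D-0017)
set_option linter.dupNamespace false

open MeasureTheory Set Filter Topology
open scoped ENNReal
open Literature.Analysis.FluidPDE Literature.Analysis.FluidPDE.Tao2016

namespace Summit.NavierStokesRegularity.NavierStokesRegularity.Theorems.PumpContinuationEulerProximatePump

/-! ### Homogeneity of the two forms under the amplitude scaling -/

/-- Homogeneity of the Euler form in its second slot, `⟨B(x, c y), z⟩ = c ⟨B(x,y), z⟩` (symmetry of `B`
and homogeneity in the first slot). [cite: Tao2016AveragedNS, §1.1 (1.3)] -/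
private theorem eulerForm_smul₂_acc (c : ℂ) (x y z : L2C) :
    eulerForm x (c • y) z = c * eulerForm x y z := by
  rw [eulerForm_symm x (c • y) z, eulerForm_smul₁, eulerForm_symm y x z]

/-- **The algebra of the amplitude normalisation.** For `θ ≠ 0` and `η = (1-θ)/θ`, the normalised form
`B + η B̃_𝒜` evaluated on `(θ a, θ b, w)` is `θ` times the segment form `(1-θ) B̃_𝒜 + θ B` on `(a, b, w)`:
`θ² B + η θ² B̃_𝒜 = θ ((1-θ) B̃_𝒜 + θ B)` since `η θ = 1 - θ` (both forms are homogeneous in the first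
two slots). [folklore] -/
private theorem normalisedForm_smul (𝒜 : AveragingDatum) {θ : ℝ} (hθ : θ ≠ 0) (a b w : L2C) :
    eulerForm (((θ : ℝ) : ℂ) • a) (((θ : ℝ) : ℂ) • b) w
        + (((1 - θ) / θ : ℝ) : ℂ) * 𝒜.form (((θ : ℝ) : ℂ) • a) (((θ : ℝ) : ℂ) • b) w =
      ((θ : ℝ) : ℂ) * (((1 - θ : ℝ) : ℂ) * 𝒜.form a b w + ((θ : ℝ) : ℂ) * eulerForm a b w) := by
  rw [eulerForm_smul₁, eulerForm_smul₂_acc, PerpetualPumpThesis.B.form_smul₁,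
    PerpetualPumpThesis.B.form_smul₂]
  have key : (((1 - θ) / θ : ℝ) : ℂ) * ((θ : ℝ) : ℂ) = ((1 - θ : ℝ) : ℂ) := by
    rw [← Complex.ofReal_mul, div_mul_cancel₀ _ hθ]
  linear_combination (((θ : ℝ) : ℂ) * 𝒜.form a b w) * key

/-! ### The registered stub -/

/-- **Stub (bookkeeping: the Door ⇒ its amplitude-normalised form).** If a symmetric cancelling
averaging datum `𝒜` and a ceiling `M` make the segment form `T_θ = (1-θ) B̃_𝒜 + θ B` admit, for `θ < 1`
arbitrarily close to `1`, a Schwartz-data `H¹⁰_df`-mild Type-I blow-up at ceiling `M` with no mild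
extension (the Door), then the normalised form `B + η B̃_𝒜` admits one at the fixed ceiling `|M|` for
arbitrarily small `η > 0`: rescale `u ↦ θ u` (scaling covariance of Tao's mild formulation,
`typeIBlowup_smul`), `η = (1-θ)/θ`, ceiling `θ M ≤ |M|`. [cite: Tao2016AveragedNS, §1.1 (1.15)] -/
theorem stub_accumulatingOfDoor :
    Theses.PumpContinuation.EulerProximatePump →
    ∃ 𝒜 : AveragingDatum, 𝒜.IsSymmetric ∧ 𝒜.HasCancellation ∧ ∃ M : ℝ, ∀ η₀ : ℝ, 0 < η₀ →
      ∃ η : ℝ, 0 < η ∧ η < η₀ ∧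
        ∃ u₀ : SchwartzMap (EuclideanSpace ℝ (Fin 3)) (EuclideanSpace ℝ (Fin 3)),
          VectorCalculus.IsDivFree ⇑u₀ ∧ ∃ S : ℝ, 0 < S ∧ ∃ u : ℝ → L2C,
            IsMildSolutionFor (fun a b c => eulerForm a b c + ((η : ℝ) : ℂ) * 𝒜.form a b c)
              (schwartzL2 u₀) (Ico 0 S) u ∧
            (∀ t ∈ Ico 0 S, eLpNorm (u t) ⊤ volume ≤ ENNReal.ofReal (M / Real.sqrt (S - t))) ∧
            ¬ ∃ S' : ℝ, S < S' ∧ ∃ v : ℝ → L2C,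
                IsMildSolutionFor (fun a b c => eulerForm a b c + ((η : ℝ) : ℂ) * 𝒜.form a b c)
                  (schwartzL2 u₀) (Ico 0 S') v ∧ ∀ t ∈ Ico 0 S, v t = u t := by
  rintro ⟨𝒜, hs, hc, M, hM⟩
  refine ⟨𝒜, hs, hc, |M|, fun η₀ hη₀ => ?_⟩
  -- choose `δ = η₀/(1+η₀)`: then `θ > 1 - δ = 1/(1+η₀)` is exactly `η = (1-θ)/θ < η₀`
  have hpos : 0 < 1 + η₀ := by linarith
  obtain ⟨θ, hθ1, hθ2, -, hw⟩ := hM (η₀ / (1 + η₀)) (div_pos hη₀ hpos)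
  have h1δ : 1 - η₀ / (1 + η₀) = 1 / (1 + η₀) := by
    rw [eq_div_iff hpos.ne', sub_mul, one_mul, div_mul_cancel₀ _ hpos.ne']
    ring
  rw [h1δ, div_lt_iff₀ hpos] at hθ1
  -- now `hθ1 : 1 < θ * (1 + η₀)`
  have hθpos : 0 < θ := (pos_iff_pos_of_mul_pos (one_pos.trans hθ1)).mpr hpos
  have hη : 0 < (1 - θ) / θ := div_pos (by linarith) hθpos
  have hηlt : (1 - θ) / θ < η₀ := by
    rw [div_lt_iff₀ hθpos]
    linarith
  -- the scaling `u ↦ θ u` carries the `T_θ`-witness to a `B + η B̃_𝒜`-witness at ceiling `θ M`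
  obtain ⟨u₀, hdiv, S, hS, u, hu, hrate, hnoext⟩ := typeIBlowup_smul
    (fun a b c => ((1 - θ : ℝ) : ℂ) * 𝒜.form a b c + ((θ : ℝ) : ℂ) * eulerForm a b c)
    (fun a b c => eulerForm a b c + (((1 - θ) / θ : ℝ) : ℂ) * 𝒜.form a b c) θ hθpos
    (fun a b w => normalisedForm_smul 𝒜 hθpos.ne' a b w) M hw
  -- upgrade the ceiling `θ M` to the fixed ceiling `|M|`
  have hθM : θ * M ≤ |M| := by nlinarith [abs_nonneg M, le_abs_self M]
  exact ⟨(1 - θ) / θ, hη, hηlt, u₀, hdiv, S, hS, u, hu, fun t ht => (hrate t ht).trans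
    (ENNReal.ofReal_le_ofReal (div_le_div_of_nonneg_right hθM (Real.sqrt_nonneg _))), hnoext⟩

end Summit.NavierStokesRegularity.NavierStokesRegularity.Theorems.PumpContinuationEulerProximatePump

end
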